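import Summits.Ventures.CertifiedArithmetic.LowPrec.GemmEnvelopeRowsPipeline

/-!
# GEMM-level envelopes, part (q): PINNED (amax-attained) per-vector witnesses (pub-lowprec gemm gen 22, LXX-q)

HONEST FRAMING: certified error envelopes and provably optimal rounding/accumulation schemes for
low-precision formats under stated cost models; every table by two implementations; no hardware or
vendor claims.

The class `C(κ)` of the decision table is stated over pairs `(a, A)`: `|aᵢ| ≤ A` and `A ≤ κ|aᵢ|` for the
non-zero `aᵢ`, the per-vector / per-tensor quantisers using `A` as scale numerator.  A per-vector
implementation takes `A = max |aᵢ|` exactly («amax»); the constant-cell witnesses of parts (d), (e), (p)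
use a numerator that is NOT attained (`15/2` with `A = 127`, `38000` with `A = 57344`).  This file shows the
gap is immaterial: PINNING a block — `(A, 0, x, …, x)` against `(0, A, x, …, x)` — keeps the class
membership, makes the numerator attained in every vector, and leaves all four GEMM sums of the body
unchanged (the pins contribute `Q(A)·Q(0) = 0`), for every element-wise quantiser `Q` with `Q 0 = 0`.
* `pinned_class`, `pinned_sums`: membership with attained numerator; the four sums.
* `row_P3_int8_fails_pipelines_amax` (`κ ≥ 254/15`, vectors of length `≥ 3`) and
  `row_P6_vecE5M2_fails_pipelines_amax` (`κ ≥ 2`): the separating sides of rows P3 and P6 under the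
  pipelines (part (p)) with amax-attained witnesses — same constants, same conclusion `C_Π·L < |c - S|`
  for every accumulation (`γ ≤ 1/2048`) and output (`δ ≤ 1/257`) realisation.
The realised rows of cert GEMM-ENVELOPES-ROBUST.json (P3_int8, P6_vec5) are already pinned (`headed`
inputs with ideal amax scaling), reproduced by two implementations with 0 diff.
[cite: RouhaniEtAl2023MX, §5.1, §6.3]; [cite: Higham2002ASNA, §3.1]
-/

namespace Summit.Ventures.CertifiedArithmetic.LowPrec.GemmEnvelope

open Finset
open Literature.ComputerArithmetic.FloatingPoint
open Literature.ComputerArithmetic.FloatingPoint.Format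
open Literature.ComputerArithmetic.FloatingPoint.MiniFloat
open Literature.ComputerArithmetic.FloatingPoint.MXBlock
open Summit.Ventures.CertifiedArithmetic.LowPrec.SR

/-- The pinned block pair `(A, 0, x, …)`, `(0, A, x, …)` with `0 < x ≤ A ≤ κx` lies in `C(κ)` with
numerator `A`, attained at position `0` resp. `1`. [cite: RouhaniEtAl2023MX, §5.1] -/
theorem pinned_class {n : ℕ} {A x κ : ℚ} (hx : 0 < x) (hxA : x ≤ A) (hκx : A ≤ κ * x)
    {a' b' : Fin (n + 3) → ℚ}
    (ha' : a' = Fin.cases A (Fin.cases (0 : ℚ) (fun _ : Fin (n + 1) => x)))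
    (hb' : b' = Fin.cases (0 : ℚ) (Fin.cases A (fun _ : Fin (n + 1) => x))) :
    (∀ i, |a' i| ≤ A ∧ (a' i = 0 ∨ A ≤ κ * |a' i|)) ∧ (∀ i, |b' i| ≤ A ∧ (b' i = 0 ∨ A ≤ κ * |b' i|)) ∧
    |a' 0| = A ∧ |b' (Fin.succ 0)| = A := by
  have hA : 0 < A := lt_of_lt_of_le hx hxA
  have hκA : A ≤ κ * A := by nlinarith
  subst ha' hb'
  refine ⟨fun i => ?_, fun i => ?_, ?_, ?_⟩
  · refine Fin.cases ?_ (fun i' => Fin.cases ?_ (fun _ => ?_) i') i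
    · simp only [Fin.cases_zero]; rw [abs_of_pos hA]; exact ⟨le_rfl, Or.inr hκA⟩
    · simp only [Fin.cases_succ, Fin.cases_zero, abs_zero]
      exact ⟨hA.le, Or.inl trivial⟩
    · simp only [Fin.cases_succ]; rw [abs_of_pos hx]; exact ⟨hxA, Or.inr hκx⟩
  · refine Fin.cases ?_ (fun i' => Fin.cases ?_ (fun _ => ?_) i') i
    · simp only [Fin.cases_zero, abs_zero]
      exact ⟨hA.le, Or.inl trivial⟩
    · simp only [Fin.cases_succ, Fin.cases_zero]; rw [abs_of_pos hA]; exact ⟨le_rfl, Or.inr hκA⟩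
    · simp only [Fin.cases_succ]; rw [abs_of_pos hx]; exact ⟨hxA, Or.inr hκx⟩
  · simp only [Fin.cases_zero]; rw [abs_of_pos hA]
  · simp only [Fin.cases_succ, Fin.cases_zero]; rw [abs_of_pos hA]

/-- The four GEMM sums of the pinned block pair under an element-wise quantiser `Q` with `Q 0 = 0`: the pins
contribute nothing. [cite: RouhaniEtAl2023MX, §5.1] -/
theorem pinned_sums {n : ℕ} {A x : ℚ} (Q : ℚ → ℚ) (hQ0 : Q 0 = 0) {a' b' : Fin (n + 3) → ℚ}
    (ha' : a' = Fin.cases A (Fin.cases (0 : ℚ) (fun _ : Fin (n + 1) => x)))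
    (hb' : b' = Fin.cases (0 : ℚ) (Fin.cases A (fun _ : Fin (n + 1) => x))) :
    (∑ i, Q (a' i) * Q (b' i) = ((n + 1 : ℕ) : ℚ) * (Q x * Q x)) ∧
    (∑ i, |Q (a' i) * Q (b' i)| = ((n + 1 : ℕ) : ℚ) * |Q x * Q x|) ∧
    (∑ i, a' i * b' i = ((n + 1 : ℕ) : ℚ) * (x * x)) ∧
    (∑ i, |a' i * b' i| = ((n + 1 : ℕ) : ℚ) * |x * x|) := by
  subst ha' hb'
  refine ⟨?_, ?_, ?_, ?_⟩
  · rw [Fin.sum_univ_succ, Fin.sum_univ_succ]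
    simp only [Fin.cases_zero, Fin.cases_succ, hQ0, mul_zero, zero_mul, zero_add, sum_const, card_univ,
      Fintype.card_fin, nsmul_eq_mul]
  · rw [Fin.sum_univ_succ, Fin.sum_univ_succ]
    simp only [Fin.cases_zero, Fin.cases_succ, hQ0, mul_zero, zero_mul, abs_zero, zero_add, sum_const,
      card_univ, Fintype.card_fin, nsmul_eq_mul]
  · rw [Fin.sum_univ_succ, Fin.sum_univ_succ]
    simp only [Fin.cases_zero, Fin.cases_succ, mul_zero, zero_mul, zero_add, sum_const, card_univ,
      Fintype.card_fin, nsmul_eq_mul]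
  · rw [Fin.sum_univ_succ, Fin.sum_univ_succ]
    simp only [Fin.cases_zero, Fin.cases_succ, mul_zero, zero_mul, abs_zero, zero_add, sum_const, card_univ,
      Fintype.card_fin, nsmul_eq_mul]

/-- **ROW P3 UNDER THE PIPELINES, AMAX-ATTAINED WITNESS**: for `κ ≥ 254/15` and vectors of length `≥ 3`
the pinned INT8 input `(127, 0, 15/2, …)·(0, 127, 15/2, …)` (numerator `127` attained in every vector,
`7.5 ↦ 8`) has output error `> C_Π·L` for EVERY realisation. [cite: RouhaniEtAl2023MX, §5.1] -/
theorem row_P3_int8_fails_pipelines_amax {B k : ℕ} (hB : 0 < B) (hk : 3 ≤ k) {κ : ℚ} (hκ : 254 / 15 ≤ κ) :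
    ∃ (a b : Fin B → Fin k → ℚ) (Aa Ab : ℚ),
      (∀ j i, |a j i| ≤ Aa ∧ (a j i = 0 ∨ Aa ≤ κ * |a j i|)) ∧ (∀ j, ∃ i, |a j i| = Aa) ∧
      (∀ j i, |b j i| ≤ Ab ∧ (b j i = 0 ∨ Ab ≤ κ * |b j i|)) ∧ (∀ j, ∃ i, |b j i| = Ab) ∧
      ∀ (γ δ acc c : ℚ), γ ≤ 1 / 2048 → δ ≤ 1 / 257 →
        |acc - ∑ j, ∑ i, (Aa / 127 * (round (a j i / (Aa / 127)) : ℚ)) *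
            (Ab / 127 * (round (b j i / (Ab / 127)) : ℚ))|
          ≤ γ * ∑ j, ∑ i, |(Aa / 127 * (round (a j i / (Aa / 127)) : ℚ)) *
            (Ab / 127 * (round (b j i / (Ab / 127)) : ℚ))| →
        |c - acc| ≤ δ * |acc| →
        (35 / 289 + 1 / 2048 * (324 / 289) + 1 / 257 * (324 / 289) * (1 + 1 / 2048))
            * ∑ j, ∑ i, |a j i * b j i| < |c - ∑ j, ∑ i, a j i * b j i| := by
  obtain ⟨n, rfl⟩ : ∃ n, k = n + 3 := ⟨k - 3, by omega⟩
  set a' : Fin (n + 3) → ℚ := Fin.cases (127 : ℚ) (Fin.cases (0 : ℚ) (fun _ : Fin (n + 1) => (15 : ℚ) / 2))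
    with ha'
  set b' : Fin (n + 3) → ℚ := Fin.cases (0 : ℚ) (Fin.cases (127 : ℚ) (fun _ : Fin (n + 1) => (15 : ℚ) / 2))
    with hb'
  obtain ⟨hca, hcb, ha0, hb1⟩ := pinned_class (n := n) (by norm_num : (0 : ℚ) < 15 / 2)
    (by norm_num : (15 : ℚ) / 2 ≤ 127) (by linarith : (127 : ℚ) ≤ κ * (15 / 2)) ha' hb'
  obtain ⟨hS1, hS1a, hS2, hS3⟩ := pinned_sums (n := n) (A := 127) (x := 15 / 2)
    (fun y : ℚ => (127 : ℚ) / 127 * (round (y / (127 / 127)) : ℚ)) (by simp) ha' hb'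
  have h8 : (127 : ℚ) / 127 * (round ((15 : ℚ) / 2 / (127 / 127)) : ℚ) = 8 := by
    have hr : round ((15 : ℚ) / 2 / (127 / 127)) = 8 := by
      rw [show (15 : ℚ) / 2 / (127 / 127) = 15 / 2 by norm_num, round_eq]; norm_num
    rw [hr]; norm_num
  rw [h8] at hS1 hS1a
  refine ⟨fun _ => a', fun _ => b', 127, 127, fun _ i => hca i, fun _ => ⟨0, ha0⟩, fun _ i => hcb i,
    fun _ => ⟨Fin.succ 0, hb1⟩, ?_⟩
  intro γ δ acc c hγ hδ hacc hc
  simp only [hS1, hS1a, hS2, hS3, sum_const, card_univ, Fintype.card_fin, nsmul_eq_mul] at hacc ⊢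
  have hN : (0 : ℚ) < (B : ℚ) * ((n + 1 : ℕ) : ℚ) := by
    have : (0 : ℚ) < (B : ℚ) := by exact_mod_cast hB
    positivity
  have e1 : ((B : ℚ) * (((n + 1 : ℕ) : ℚ) * (8 * 8)) : ℚ) = (B : ℚ) * ((n + 1 : ℕ) : ℚ) * (8 * 8) := by ring
  have e2 : ((B : ℚ) * (((n + 1 : ℕ) : ℚ) * |(8 : ℚ) * 8|) : ℚ) = (B : ℚ) * ((n + 1 : ℕ) : ℚ) * |(8 : ℚ) * 8| := by
    ring
  have e3 : ((B : ℚ) * (((n + 1 : ℕ) : ℚ) * ((15 : ℚ) / 2 * (15 / 2))) : ℚ)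
      = (B : ℚ) * ((n + 1 : ℕ) : ℚ) * (15 / 2 * (15 / 2)) := by ring
  have e4 : ((B : ℚ) * (((n + 1 : ℕ) : ℚ) * |(15 : ℚ) / 2 * (15 / 2)|) : ℚ)
      = (B : ℚ) * ((n + 1 : ℕ) : ℚ) * |(15 : ℚ) / 2 * (15 / 2)| := by ring
  rw [e1, e2] at hacc
  rw [e3, e4]
  exact pipeline_witness_up hN (by norm_num) (by norm_num) hγ hδ hacc hc (by norm_num)

/-- **ROW P6 UNDER THE PIPELINES, AMAX-ATTAINED WITNESS**: for `κ ≥ 2` and vectors of length `≥ 3` the pinned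
per-vector-E5M2 input `(57344, 0, 38000, …)·(0, 57344, 38000, …)` (numerator `57344 = E5M2.maxRat` attained,
`38000 ↦ 40960`) has output error `> C_Π·L` for EVERY realisation. [cite: RouhaniEtAl2023MX, §6.3] -/
theorem row_P6_vecE5M2_fails_pipelines_amax {B k : ℕ} (hB : 0 < B) (hk : 3 ≤ k) {κ : ℚ} (hκ : 2 ≤ κ) :
    ∃ (a b : Fin B → Fin k → ℚ) (Aa Ab : ℚ),
      (∀ j i, |a j i| ≤ Aa ∧ (a j i = 0 ∨ Aa ≤ κ * |a j i|)) ∧ (∀ j, ∃ i, |a j i| = Aa) ∧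
      (∀ j i, |b j i| ≤ Ab ∧ (b j i = 0 ∨ Ab ≤ κ * |b j i|)) ∧ (∀ j, ∃ i, |b j i| = Ab) ∧
      ∀ (γ δ acc c : ℚ), γ ≤ 1 / 2048 → δ ≤ 1 / 257 →
        |acc - ∑ j, ∑ i, (Aa / E5M2.maxRat * (roundNE E5M2 (a j i / (Aa / E5M2.maxRat))).toRat) *
            (Ab / E5M2.maxRat * (roundNE E5M2 (b j i / (Ab / E5M2.maxRat))).toRat)|
          ≤ γ * ∑ j, ∑ i, |(Aa / E5M2.maxRat * (roundNE E5M2 (a j i / (Aa / E5M2.maxRat))).toRat) *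
            (Ab / E5M2.maxRat * (roundNE E5M2 (b j i / (Ab / E5M2.maxRat))).toRat)| →
        |c - acc| ≤ δ * |acc| →
        (35 / 289 + 1 / 2048 * (324 / 289) + 1 / 257 * (324 / 289) * (1 + 1 / 2048))
            * ∑ j, ∑ i, |a j i * b j i| < |c - ∑ j, ∑ i, a j i * b j i| := by
  obtain ⟨n, rfl⟩ : ∃ n, k = n + 3 := ⟨k - 3, by omega⟩
  have hM5 : E5M2.maxRat = 57344 := witness_values.2.2.2.2.2.2.2.2.1
  set a' : Fin (n + 3) → ℚ := Fin.cases (57344 : ℚ) (Fin.cases (0 : ℚ) (fun _ : Fin (n + 1) => (38000 : ℚ)))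
    with ha'
  set b' : Fin (n + 3) → ℚ := Fin.cases (0 : ℚ) (Fin.cases (57344 : ℚ) (fun _ : Fin (n + 1) => (38000 : ℚ)))
    with hb'
  obtain ⟨hca, hcb, ha0, hb1⟩ := pinned_class (n := n) (by norm_num : (0 : ℚ) < 38000)
    (by norm_num : (38000 : ℚ) ≤ 57344) (by linarith : (57344 : ℚ) ≤ κ * 38000) ha' hb'
  have hQ0 : (57344 : ℚ) / E5M2.maxRat * (roundNE E5M2 (0 / (57344 / E5M2.maxRat))).toRat = 0 := by
    rw [zero_div, toRat_roundNE_zero, mul_zero]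
  obtain ⟨hS1, hS1a, hS2, hS3⟩ := pinned_sums (n := n) (A := 57344) (x := 38000)
    (fun y : ℚ => (57344 : ℚ) / E5M2.maxRat * (roundNE E5M2 (y / (57344 / E5M2.maxRat))).toRat) hQ0 ha' hb'
  have hq : (57344 : ℚ) / E5M2.maxRat * (roundNE E5M2 (38000 / (57344 / E5M2.maxRat))).toRat = 40960 := by
    rw [hM5, div_self (by norm_num : (57344 : ℚ) ≠ 0), div_one, witness_values.2.2.2.2.2.2.1, one_mul]
  rw [hq] at hS1 hS1a
  refine ⟨fun _ => a', fun _ => b', 57344, 57344, fun _ i => hca i, fun _ => ⟨0, ha0⟩, fun _ i => hcb i,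
    fun _ => ⟨Fin.succ 0, hb1⟩, ?_⟩
  intro γ δ acc c hγ hδ hacc hc
  simp only [hS1, hS1a, hS2, hS3, sum_const, card_univ, Fintype.card_fin, nsmul_eq_mul] at hacc ⊢
  have hN : (0 : ℚ) < (B : ℚ) * ((n + 1 : ℕ) : ℚ) := by
    have : (0 : ℚ) < (B : ℚ) := by exact_mod_cast hB
    positivity
  have e1 : ((B : ℚ) * (((n + 1 : ℕ) : ℚ) * (40960 * 40960)) : ℚ) = (B : ℚ) * ((n + 1 : ℕ) : ℚ) * (40960 * 40960) := by
    ring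
  have e2 : ((B : ℚ) * (((n + 1 : ℕ) : ℚ) * |(40960 : ℚ) * 40960|) : ℚ)
      = (B : ℚ) * ((n + 1 : ℕ) : ℚ) * |(40960 : ℚ) * 40960| := by ring
  have e3 : ((B : ℚ) * (((n + 1 : ℕ) : ℚ) * (38000 * 38000)) : ℚ) = (B : ℚ) * ((n + 1 : ℕ) : ℚ) * (38000 * 38000) := by
    ring
  have e4 : ((B : ℚ) * (((n + 1 : ℕ) : ℚ) * |(38000 : ℚ) * 38000|) : ℚ)
      = (B : ℚ) * ((n + 1 : ℕ) : ℚ) * |(38000 : ℚ) * 38000| := by ring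
  rw [e1, e2] at hacc
  rw [e3, e4]
  exact pipeline_witness_up hN (by norm_num) (by norm_num) hγ hδ hacc hc (by norm_num)

end Summit.Ventures.CertifiedArithmetic.LowPrec.GemmEnvelope
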